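import Literature.Topology.FourManifolds.TrisectionsSetupBoxes
import Literature.Topology.FourManifolds.TrisectionsHeegaardSplitting
import Literature.Topology.FourManifolds.TrisectionsZetaFrame
import Literature.Topology.FourManifolds.GradientLikeUnitField
import Literature.Topology.FourManifolds.MorseLevelConnected
import Literature.Topology.FourManifolds.LevelBlending
import HarnessLib

/-!
# Setting up the Morse-theoretic trisection, II: the unit field, the Heegaard function and the
# bi-collar

Topic `Literature/Topology/FourManifolds`; step H (part b-2) of a Morse-theoretic construction of
Gay–Kirby's trisection for the fact seat
`provefact-Literature.Topology.FourManifolds.exists_isBalancedGKTrisection` (Gay–Kirby 2016,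
Thm. 4 via §4, Lemma 14).  Everything in this file is **proved**; the definitions are a data
structure and the bi-collar, gradient-like frame and handle boxes read off it.

Continuing `TrisectionsSetupBoxes.lean` (`SetupBoxes`: `f`, `ζ`, the `2`-handle boxes over the
level `a = 2 - η`), we fix (`exists_setupCollar`):

* the regularity of the level `a` (no critical value of the self-indexing `f` in `(1, 2)`);
* a **unit-speed field `U` across the level which is a positive multiple of `ζ`**, `U.ξ = ρ_U • ζ`,
  with band half-width `η/2` (`exists_levelUnitField_smul_of_band`: Milnor's normalisation `1/ζ(f)` on the
  band, blended to `1` near the critical points — the proof of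
  `IsMorse.exists_levelUnitField_isGradientLike` run for the given `ζ` and band);
* the connectedness of the levels `f⁻¹(a)` and `f⁻¹(a + 1.9η)` (`MorseLevelConnected.lean`: one
  minimum, indices `≤ 2` below);
* **the Heegaard function `g` of the level adapted to the attaching circles**
  (`TubeSystem.exists_heegaardFunction` for the tube system of the boxes with tube parameters
  a prescribed `ε_T ∈ (0, 1/2]`, `κ = 2/η`, `δ = 1`): Morse, ordered with respect to its regular value
  `b ∈ (1/2, 1)`, equal to `𝒯/7` on the tubes `{𝒯 < 3}` of the boxes (`hφ`, through
  `coord_eq_centred`), with critical points on the tubes only on the attaching circles (`hgtube`,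
  from `TubeSystem.morseData_of_isMCriticalPt`), both sides `{g ≤ b}`, `{g ≥ b}` connected;
* a unit field `V` across `{g = b}` in the level and a point of `{g = b}` (intermediate value
  theorem on the connected level).

These give the bi-collar `B = (f, a, U, g, b, V)` (`SetupCollar.bc`, `TrisectionsBiCollar.lean`),
its gradient-like frame `Z = (ζ, ρ_U)` (`SetupCollar.zf`, `TrisectionsZetaFrame.lean`) and the
handle boxes of `Z.ζ` over `B` (`SetupCollar.hb`).

## References

* D. Gay, R. Kirby, *Trisecting 4-manifolds*, Geom. Topol. 20 (2016), §4, Lemma 14 and proof of Thm. 4. [GayKirby2016]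
* J. Milnor, *Lectures on the h-cobordism theorem* (1965), Def. 3.1, Lemma 3.2, proof of Thm. 3.4, Thms. 2.7, 4.8, 8.1. [MilnorHCobordism1965]
-/

open scoped Manifold ContDiff Topology
open Set Function Filter Metric

noncomputable section

universe u

namespace Literature.Topology.FourManifolds

/-- Local notation: `𝔼 n` is the model Euclidean space `EuclideanSpace ℝ (Fin n)`. -/
local notation "𝔼 " n:arg => EuclideanSpace ℝ (Fin n)

/-! ### A unit field across a level which is a multiple of a given gradient-like field -/

section UnitField

variable {n : ℕ} {M : Type u} [TopologicalSpace M] [T2Space M]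
  [CompactSpace M] [ChartedSpace (EuclideanSpace ℝ (Fin (n + 1))) M] [IsManifold (𝓡 (n + 1)) ∞ M]

/-- **A unit-speed field across a regular band which is a positive multiple of a given
gradient-like field** (Milnor 1965, proof of Thm. 3.4: multiply `ζ` by `1/ζ(f)` on the band; here
blended to `1` near the critical points so that the field stays gradient-like).  Given a Morse
function `f`, a smooth gradient-like `ζ`, and a band `f⁻¹[a - δ, a + δ]` (`δ > 0`) without
critical points, there are a unit-speed field `U` across the level `a` with band half-width
exactly `δ` and a smooth positive `ρ` with `U.ξ = ρ • ζ`, `U.ξ` gradient-like. [cite: MilnorHCobordism1965, Lemma 3.2 and proof of Thm. 3.4 (PDF pp. 12–13)] -/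
theorem exists_levelUnitField_smul_of_band {f : M → ℝ} (hf : IsMorse (𝓡 (n + 1)) f)
    {ζ : Π x : M, TangentSpace (𝓡 (n + 1)) x}
    (hζs : ContMDiff (𝓡 (n + 1)) (𝓡 (n + 1)).tangent ∞ fun x => (⟨x, ζ x⟩ : TangentBundle (𝓡 (n + 1)) M))
    (hζ : IsGradientLike (𝓡 (n + 1)) f ζ) {a δ : ℝ} (hδ : 0 < δ)
    (hreg : ∀ x, f x ∈ Icc (a - δ) (a + δ) → ¬ IsMCriticalPt (𝓡 (n + 1)) f x) :
    ∃ (U : LevelUnitField n f a) (ρ : M → ℝ), U.δ = δ ∧ ContMDiff (𝓡 (n + 1)) 𝓘(ℝ, ℝ) ∞ ρ ∧ (∀ x, 0 < ρ x) ∧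
      (∀ x, U.ξ x = ρ x • ζ x) ∧ IsGradientLike (𝓡 (n + 1)) f U.ξ := by
  have hfs : ContMDiff (𝓡 (n + 1)) 𝓘(ℝ, ℝ) ∞ f := hf.1
  set Bd : Set M := f ⁻¹' Icc (a - δ) (a + δ) with hBd
  have hBdc : IsClosed Bd := isClosed_Icc.preimage hfs.continuous
  have hBdK : IsCompact Bd := hBdc.isCompact
  -- `ζ(f)` is smooth and positive on the band
  set ζf : M → ℝ := fun x => mlineDeriv (𝓡 (n + 1)) f x (ζ x) with hζf
  have hζfs : ContMDiff (𝓡 (n + 1)) 𝓘(ℝ, ℝ) ∞ ζf := contMDiff_mlineDeriv_section hfs hζs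
  have hζfc : Continuous ζf := hζfs.continuous
  have hζfpos : ∀ x ∈ Bd, 0 < ζf x := fun x hx => hζ.mlineDeriv_pos x (hreg x hx)
  -- a positive lower bound `m₀` of `ζ(f)` on the band
  obtain ⟨m₀, hm₀, hm₀le⟩ : ∃ m₀ : ℝ, 0 < m₀ ∧ ∀ x ∈ Bd, m₀ ≤ ζf x := by
    by_cases hne : Bd.Nonempty
    · obtain ⟨x₀, hx₀, hmin⟩ := hBdK.exists_isMinOn hne hζfc.continuousOn
      exact ⟨ζf x₀, hζfpos x₀ hx₀, fun x hx => hmin hx⟩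
    · exact ⟨1, one_pos, fun x hx => (hne ⟨x, hx⟩).elim⟩
  -- a smooth cut-off `φ`: `1` on the band, `0` on `{ζ(f) ≤ 2 m₀ / 3}`
  set mlo : ℝ := m₀ / 3 with hmlo
  set mhi : ℝ := 2 * m₀ / 3 with hmhi
  have hmlo0 : 0 < mlo := by rw [hmlo]; linarith
  have hlt : mlo < mhi := by rw [hmlo, hmhi]; linarith
  have hhi : mhi < m₀ := by rw [hmhi]; linarith
  have hZc : IsClosed {x : M | ζf x ≤ mhi} := isClosed_le hζfc continuous_const
  have hdisj : Disjoint {x : M | ζf x ≤ mhi} Bd := by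
    rw [disjoint_left]
    intro x hx hxB
    exact absurd ((hm₀le x hxB).trans hx) (not_le.2 hhi)
  obtain ⟨φ, hφ0, hφ1, hφ01⟩ := exists_contMDiffMap_zero_one_of_isClosed (I := 𝓡 (n + 1)) (n := ⊤) hZc hBdc hdisj
  have hφs : ContMDiff (𝓡 (n + 1)) 𝓘(ℝ, ℝ) ∞ φ := φ.contMDiff
  -- the rescaling factor `ρ = φ / ζ(f) + (1 - φ)`
  set ρ : M → ℝ := fun x => φ x / ζf x + (1 - φ x) with hρ
  have hρ_of_lt : ∀ x, ζf x < mhi → ρ x = 1 := fun x hx => by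
    have : φ x = 0 := hφ0 (le_of_lt hx)
    simp only [hρ, this, zero_div, sub_zero, zero_add]
  have hρB : ∀ x ∈ Bd, ρ x = 1 / ζf x := fun x hx => by
    have : φ x = 1 := hφ1 hx
    simp only [hρ, this, sub_self, add_zero]
  have hρpos : ∀ x, 0 < ρ x := fun x => by
    rcases lt_or_ge (ζf x) mhi with h | h
    · rw [hρ_of_lt x h]; exact one_pos
    · have hζx : 0 < ζf x := hmlo0.trans (hlt.trans_le h)
      have h01 := hφ01 x
      show 0 < φ x / ζf x + (1 - φ x)
      rcases h01.2.lt_or_eq with hφlt | hφeq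
      · have : 0 ≤ φ x / ζf x := div_nonneg h01.1 hζx.le
        linarith
      · rw [hφeq, sub_self, add_zero]; exact div_pos one_pos hζx
  have hρs : ContMDiff (𝓡 (n + 1)) 𝓘(ℝ, ℝ) ∞ ρ := by
    intro x
    rcases lt_or_ge (ζf x) mhi with h | h
    · have hopen : IsOpen {y : M | ζf y < mhi} := isOpen_lt hζfc continuous_const
      have hev : ρ =ᶠ[𝓝 x] fun _ => 1 := by
        filter_upwards [hopen.mem_nhds h] with y hy
        exact hρ_of_lt y hy
      exact contMDiffAt_const.congr_of_eventuallyEq hev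
    · have hopen : IsOpen {y : M | mlo < ζf y} := isOpen_lt continuous_const hζfc
      have hx : x ∈ {y : M | mlo < ζf y} := hlt.trans_le h
      have hon : ContMDiffOn (𝓡 (n + 1)) 𝓘(ℝ, ℝ) ∞ ρ {y : M | mlo < ζf y} :=
        ((hφs.contMDiffOn.div₀ hζfs.contMDiffOn fun y hy => (hmlo0.trans hy).ne')).add
          (contMDiffOn_const.sub hφs.contMDiffOn)
      exact hon.contMDiffAt (hopen.mem_nhds hx)
  -- the field `ξ = ρ ζ`
  set ξ : Π x : M, TangentSpace (𝓡 (n + 1)) x := fun x => ρ x • ζ x with hξ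
  have hξs : ContMDiff (𝓡 (n + 1)) (𝓡 (n + 1)).tangent ∞
      fun x => (⟨x, ξ x⟩ : TangentBundle (𝓡 (n + 1)) M) :=
    ContMDiff.smul_section (I := 𝓡 (n + 1)) (F := EuclideanSpace ℝ (Fin (n + 1))) (V := TangentSpace (𝓡 (n + 1))) hρs hζs
  have hξf : ∀ x, mlineDeriv (𝓡 (n + 1)) f x (ξ x) = ρ x * ζf x := fun x => mlineDeriv_smul f x (ρ x) (ζ x)
  refine ⟨⟨ξ, hξs, hfs, δ, hδ, fun x hx => ?_⟩, ρ, rfl, hρs, hρpos, fun x => rfl, ?_⟩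
  · rw [hξf, hρB x hx, one_div, inv_mul_cancel₀ (hζfpos x hx).ne']
  · refine hζ.of_locallyEq (fun p hp => ?_) (fun p hp => ?_)
    · rw [hξf]; exact mul_pos (hρpos p) (hζ.mlineDeriv_pos p hp)
    · refine ⟨{y : M | ζf y < mhi}, isOpen_lt hζfc continuous_const, ?_, fun _ _ => rfl, fun q hq => ?_⟩
      · show ζf p < mhi
        rw [show ζf p = 0 from mlineDeriv_eq_zero_of_isMCriticalPt hp _]
        exact hmlo0.trans hlt
      · show ρ q • ζ q = ζ q
        rw [hρ_of_lt q hq, one_smul]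

end UnitField

/-! ### The tube parameters and the self-indexing arithmetic -/

namespace SetupBoxes

variable {X : Type u} [TopologicalSpace X] [ChartedSpace (𝔼 4) X] [IsManifold (𝓡 4) ∞ X] (P : SetupBoxes X)

/-- The radial coefficient of the tube function, `κ = 2/η`. [cite: GayKirby2016, §4, Lemma 14] -/
def kap : ℝ := 2 / P.η

/-- `κ = 2/η`. [folklore] -/
theorem kap_eq : P.kap = 2 / P.η := rfl

/-- `κ > 0`. [folklore] -/
theorem kap_pos : 0 < P.kap := by rw [kap_eq]; exact div_pos two_pos P.eta_pos

/-- `κ η = 2`. [folklore] -/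
theorem kap_mul_eta : P.kap * P.η = 2 := by rw [kap_eq]; field_simp [P.eta_pos.ne']

/-- **The size condition of the Heegaard function**: `3η/2 + 2ρ² ≤ R²` for `ρ² = 2(5 + ε)/κ = (5 + ε)η`
and `ε ≤ 1/2` (`η ≤ R²/25`). [folklore] -/
theorem size_le {ε : ℝ} (hε1 : ε ≤ 1 / 2) : 3 * P.η / 2 + 2 * TubeSystem.rhoSq ε P.kap 1 ≤ P.tubeSystem.R ^ 2 := by
  rw [tubeSystem_R, TubeSystem.rhoSq, kap_eq]
  have hη := P.eta_pos
  have hηR := P.hηR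
  have h1 : 2 * (2 * (5 * 1 + ε) / (2 / P.η)) = 2 * (5 + ε) * P.η := by
    rw [div_div_eq_mul_div]; ring
  rw [h1]
  nlinarith

/-- A critical value of the self-indexing `f` is a natural number. [folklore] -/
theorem exists_nat_of_isMCriticalPt {x : X} (hc : IsMCriticalPt (𝓡 4) P.f x) : ∃ m : ℕ, P.f x = m :=
  ⟨_, P.hsi x hc⟩

/-- **No critical value strictly between consecutive integers.** [folklore] -/
theorem not_isMCriticalPt_of_Ioo {x : X} (m : ℕ) (h₁ : (m : ℝ) < P.f x) (h₂ : P.f x < m + 1) :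
    ¬ IsMCriticalPt (𝓡 4) P.f x := fun hc => by
  obtain ⟨k, hk⟩ := P.exists_nat_of_isMCriticalPt hc
  rw [hk] at h₁ h₂
  have h1 : m < k := by exact_mod_cast h₁
  have h2 : k < m + 1 := by exact_mod_cast h₂
  omega

/-- The level `a = 2 - η` and the band `[a - η/2, a + η/2]` lie in `(1, 2)`; `a + 1.9η ∈ (2, 3)`. [folklore] -/
theorem level_bounds : (1 : ℝ) < 2 - P.η - P.η ∧ 2 - P.η + P.η / 2 < 2 ∧ (2 : ℝ) < 2 - P.η + 19 / 10 * P.η ∧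
    2 - P.η + 19 / 10 * P.η < 3 := by
  have := P.eta_pos; have := P.hη8
  refine ⟨by linarith, by linarith, by linarith, by linarith⟩

/-- **The level `a` is regular.** [folklore] -/
theorem isRegularLevel_a : IsRegularLevel (𝓡 4) P.f (2 - P.η) where
  contMDiff := P.hfM.contMDiff
  isInteriorPoint _ _ := BoundarylessManifold.isInteriorPoint
  not_isMCriticalPt x hx := P.not_isMCriticalPt_of_Ioo 1 (by rw [hx]; push_cast; linarith [P.level_bounds.1, P.eta_pos])
    (by rw [hx]; push_cast; linarith [P.eta_pos])

/-- No critical point in the band `[a - η/2, a + η/2]` of the unit field. [folklore] -/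
theorem not_isMCriticalPt_of_band {x : X} (hx : P.f x ∈ Icc (2 - P.η - P.η / 2) (2 - P.η + P.η / 2)) :
    ¬ IsMCriticalPt (𝓡 4) P.f x :=
  P.not_isMCriticalPt_of_Ioo 1 (by push_cast; linarith [hx.1, P.level_bounds.1, P.eta_pos]) (by push_cast; linarith [hx.2, P.level_bounds.2.1])

/-- **The level `a + 1.9η` is regular.** [folklore] -/
theorem isRegularLevel_ℓ : IsRegularLevel (𝓡 4) P.f (2 - P.η + 19 / 10 * P.η) where
  contMDiff := P.hfM.contMDiff
  isInteriorPoint _ _ := BoundarylessManifold.isInteriorPoint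
  not_isMCriticalPt x hx := P.not_isMCriticalPt_of_Ioo 2 (by rw [hx]; push_cast; linarith [P.level_bounds.2.2.1])
    (by rw [hx]; push_cast; linarith [P.level_bounds.2.2.2])

/-- There is one minimum: the critical set of index `0` is a singleton. [folklore] -/
theorem subsingleton_crit₀ : (criticalSetOfIndex (𝓡 4) P.f 0).Subsingleton := by
  obtain ⟨m, hm⟩ := Set.ncard_eq_one.1 P.hc0
  rw [hm]; exact subsingleton_singleton

/-- The minimum has value `0 ≤ t` for every `t ≥ 0`. [folklore] -/
theorem exists_apply_le {t : ℝ} (ht : 0 ≤ t) : ∃ x, P.f x ≤ t := by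
  obtain ⟨m, hm⟩ := Set.ncard_eq_one.1 P.hc0
  have hmem : m ∈ criticalSetOfIndex (𝓡 4) P.f 0 := by rw [hm]; exact rfl
  refine ⟨m, ?_⟩
  rw [P.hsi m hmem.1, hmem.2]; push_cast; exact ht

variable [T2Space X] [CompactSpace X]

/-- **A level `f⁻¹(t)` with `t < 3` of the balanced self-indexing `f` is connected** (one minimum;
critical points below have index `≤ 2`). [cite: Milnor1963, Thms. 3.1–3.2, Rem. 3.3] -/
theorem connectedSpace_level {t : ℝ} (ht0 : 0 ≤ t) (ht : t < 3) (h : IsRegularLevel (𝓡 4) P.f t) :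
    ConnectedSpace (RegularLevel h) :=
  connectedSpace_regularLevel (k := 3) P.hfM h P.subsingleton_crit₀
    (fun z hc hz => by
      obtain ⟨m, hm⟩ := P.exists_nat_of_isMCriticalPt hc
      have hidx : P.f z = morseIndex (𝓡 4) P.f z := P.hsi z hc
      have hlt : (morseIndex (𝓡 4) P.f z : ℝ) < 3 := by rw [← hidx]; linarith
      have : morseIndex (𝓡 4) P.f z < 3 := by exact_mod_cast hlt
      change morseIndex (𝓡 4) P.f z + 2 ≤ 3 + 1
      omega)
    (P.exists_apply_le ht0)

end SetupBoxes

/-! ### The collar data -/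

variable (X : Type u) [TopologicalSpace X] [T2Space X] [CompactSpace X] [ChartedSpace (𝔼 4) X] [IsManifold (𝓡 4) ∞ X]

/-- **The collar data of the construction**: the boxes (`SetupBoxes`) together with the unit
field across the level (a positive multiple of `ζ`), the adapted Heegaard function of the level
and its regular value `b`, the unit field across `{g = b}` in the level, and the connectedness
of the levels. [cite: GayKirby2016, §4, Lemma 14 and proof of Thm. 4] -/
structure SetupCollar extends SetupBoxes X where
  /-- The angular amplitude of the tube function. -/
  εT : ℝ
  /-- It is positive. -/
  hεT0 : 0 < εT
  /-- It is at most `1/2`. -/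
  hεT1 : εT ≤ 1 / 2
  /-- The level `a = 2 - η` is regular. -/
  hfa : IsRegularLevel (𝓡 4) f (2 - η)
  /-- The unit field across the level. -/
  U : LevelUnitField 3 f (2 - η)
  /-- The speed factor. -/
  ρU : X → ℝ
  /-- The band half-width is `η/2`. -/
  hUδ : U.δ = η / 2
  /-- The speed factor is continuous. -/
  hρUc : Continuous ρU
  /-- The speed factor is positive. -/
  hρU : ∀ x, 0 < ρU x
  /-- `U.ξ = ρ_U • ζ`. -/
  hU_eq : ∀ x, U.ξ x = ρU x • ζ x
  /-- `U.ξ` is gradient-like. -/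
  hglU : IsGradientLike (𝓡 4) f U.ξ
  /-- The level is connected. -/
  connY : ConnectedSpace (RegularLevel hfa)
  /-- The Heegaard function of the level. -/
  g : RegularLevel hfa → ℝ
  /-- Its regular value. -/
  b : ℝ
  /-- `b` is regular. -/
  hb : IsRegularLevel (𝓡 3) g b
  /-- `g` is Morse. -/
  gMorse : IsMorse (𝓡 3) g
  /-- `g` takes values in `(0, 1)`. -/
  hgval : ∀ y, g y ∈ Ioo 0 1
  /-- `b > 1/2`. -/
  hb_lo : 1 / 2 < b
  /-- `b < 1`. -/
  hb_hi : b < 1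
  /-- Critical points below `b` have index `≤ 1`. -/
  hgord₁ : ∀ y, IsMCriticalPt (𝓡 3) g y → g y < b → morseIndex (𝓡 3) g y ≤ 1
  /-- Critical points above `b` have index `≥ 2`. -/
  hgord₂ : ∀ y, IsMCriticalPt (𝓡 3) g y → b < g y → 2 ≤ morseIndex (𝓡 3) g y
  /-- On the tubes of the boxes, `g = 𝒯/7`. -/
  hφ : ∀ j (y : RegularLevel hfa), y.1 ∈ (H.box j).chart.source →
    TubeModel.tube εT (2 / η) η ((H.box j).coord y.1) < 3 →
    g y = 1 / 7 * TubeModel.tube εT (2 / η) η ((H.box j).coord y.1)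
  /-- On the tubes, the critical points of `g` are on the attaching circles. -/
  hgtube : ∀ j (y : RegularLevel hfa), y.1 ∈ (H.box j).chart.source →
    TubeModel.tube εT (2 / η) η ((H.box j).coord y.1) < 3 →
    IsMCriticalPt (𝓡 3) g y → H.B j y.1 = 0
  /-- `{g ≤ b}` is connected. -/
  conn₁ : ConnectedSpace (RegularSublevel hb)
  /-- `{g ≥ b}` is connected. -/
  conn₂ : ConnectedSpace (RegularSuperlevel hb)
  /-- The unit field across `{g = b}` in the level. -/
  V : LevelUnitField 2 g b
  /-- `{g = b}` is nonempty. -/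
  nonempty_F : Nonempty (RegularLevel hb)
  /-- The level `a + 1.9η` is regular. -/
  hℓreg : IsRegularLevel (𝓡 4) f (2 - η + 19 / 10 * η)
  /-- It is connected. -/
  connℓ : ConnectedSpace (RegularLevel hℓreg)

namespace SetupCollar

variable {X} (C : SetupCollar X)

/-- **The bi-collar of the construction.** [cite: GayKirby2016, §4, Lemma 14] -/
def bc : BiCollar X := ⟨C.f, 2 - C.η, C.hfa, C.U, C.g, C.b, C.hb, C.V, C.nonempty_F⟩

omit [T2Space X] [CompactSpace X] in
/-- The function of the bi-collar is `f`. [folklore] -/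
@[simp] theorem bc_f : C.bc.f = C.f := rfl
omit [T2Space X] [CompactSpace X] in
/-- The level of the bi-collar is `a = 2 - η`. [folklore] -/
@[simp] theorem bc_a : C.bc.a = 2 - C.η := rfl
omit [T2Space X] [CompactSpace X] in
/-- The unit field of the bi-collar is `U`. [folklore] -/
@[simp] theorem bc_U : C.bc.U = C.U := rfl
omit [T2Space X] [CompactSpace X] in
/-- The Heegaard function of the bi-collar is `g`. [folklore] -/
@[simp] theorem bc_g : C.bc.g = C.g := rfl
omit [T2Space X] [CompactSpace X] in
/-- The regular value of the bi-collar is `b`. [folklore] -/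
@[simp] theorem bc_b : C.bc.b = C.b := rfl
omit [T2Space X] [CompactSpace X] in
/-- The regularity datum of the bi-collar. [folklore] -/
theorem bc_hf : C.bc.hf = C.hfa := rfl
omit [T2Space X] [CompactSpace X] in
/-- The regularity datum of `b`. [folklore] -/
theorem bc_hg : C.bc.hg = C.hb := rfl

/-- **The gradient-like frame of the construction** (`U.ξ = ρ_U • ζ`). [cite: MilnorHCobordism1965, Def. 3.1 and proof of Thm. 3.4] -/
def zf : C.bc.ZFrame := ⟨C.ζ, C.hζ, C.hgl, ⟨C.hfM, C.hglU⟩, C.ρU, C.hρUc, C.hρU, C.hU_eq⟩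

omit [T2Space X] [CompactSpace X] in
/-- The field of the frame is `ζ`. [folklore] -/
@[simp] theorem zf_ζ : C.zf.ζ = C.ζ := rfl

/-- **The handle boxes of the frame over the bi-collar.** [cite: GayKirby2016, §4, Lemma 14] -/
def hb' : HandleBoxes C.bc.f C.zf.ζ C.bc.a C.η C.ι := C.H

omit [T2Space X] [CompactSpace X] in
/-- The boxes are those of the set-up. [folklore] -/
@[simp] theorem hb'_eq : C.hb' = C.H := rfl

end SetupCollar

/-! ### Existence -/

variable [SecondCountableTopology X] [ConnectedSpace X]

variable {X} in
omit [ConnectedSpace X] in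
/-- **Existence of the collar data over given boxes, for any tube amplitude `ε_T ∈ (0, 1/2]`.** [cite: GayKirby2016, §4, Lemma 14 and proof of Thm. 4] [cite: MilnorHCobordism1965, Lemma 3.2, proof of Thm. 3.4, Thms. 2.7, 4.8, 8.1] -/
theorem SetupBoxes.exists_collar (P : SetupBoxes X) {εT : ℝ} (hεT0 : 0 < εT) (hεT1 : εT ≤ 1 / 2) :
    ∃ C : SetupCollar X, C.toSetupBoxes = P ∧ C.εT = εT := by
  classical
  have hη := P.eta_pos
  have hη8 := P.hη8
  have hfs : ContMDiff (𝓡 4) 𝓘(ℝ, ℝ) ∞ P.f := P.hfM.contMDiff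
  -- the level and the unit field
  have hfa : IsRegularLevel (𝓡 4) P.f P.a := P.isRegularLevel_a
  obtain ⟨U, ρU, hUδ, hρUs, hρU, hU_eq, hglU⟩ := exists_levelUnitField_smul_of_band (n := 3) P.hfM P.hζ P.hgl (a := 2 - P.η)
    (δ := P.η / 2) (by linarith) fun x hx => P.not_isMCriticalPt_of_band (by
      obtain ⟨h1, h2⟩ := hx; exact ⟨by linarith, by linarith⟩)
  -- the connected levels
  haveI connY : ConnectedSpace (RegularLevel hfa) :=
    P.connectedSpace_level (by rw [P.a_def]; linarith) (by rw [P.a_def]; linarith) hfa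
  have hℓreg : IsRegularLevel (𝓡 4) P.f (2 - P.η + 19 / 10 * P.η) := P.isRegularLevel_ℓ
  have connℓ : ConnectedSpace (RegularLevel hℓreg) := P.connectedSpace_level (by linarith) (by linarith) hℓreg
  -- the Heegaard function
  obtain ⟨g, b, hb, gMorse, hgval, htb, hb1, hgord₁, hgord₂, hexpl, conn₁, conn₂, -⟩ :=
    P.tubeSystem.exists_heegaardFunction (h := hfa) (ε := εT) (κ := P.kap) (δ := 1) (P.size_le hεT1) hεT0 hεT1 P.kap_pos
      one_pos le_rfl
  have hb_lo : 1 / 2 < b := by norm_num at htb; linarith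
  -- the explicit form on the tubes of the boxes
  have hF_tube : ∀ j (y : RegularLevel hfa), y.1 ∈ (P.H.box j).chart.source →
      TubeModel.tube εT P.kap P.η ((P.H.box j).coord y.1) < 3 →
      P.tubeSystem.heegaardFn εT P.kap 1 y.1 = TubeModel.tube εT P.kap P.η ((P.H.box j).coord y.1) := by
    intro j y hy ht
    rw [P.coord_eq_centred] at ht ⊢
    exact P.tubeSystem.heegaardFn_eq_tube (ε := εT) (κ := P.kap) (δ := 1) hfs one_pos j y.2
      (by simpa using hy) (by linarith)
  have hφ : ∀ j (y : RegularLevel hfa), y.1 ∈ (P.H.box j).chart.source →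
      TubeModel.tube εT (2 / P.η) P.η ((P.H.box j).coord y.1) < 3 →
      g y = 1 / 7 * TubeModel.tube εT (2 / P.η) P.η ((P.H.box j).coord y.1) := by
    intro j y hy ht
    rw [← P.kap_eq] at ht ⊢
    have hF := hF_tube j y hy ht
    have hlt : P.tubeSystem.heegaardFn εT P.kap 1 y.1 < 1 + 2 * 1 := by rw [hF]; linarith
    rw [hexpl y hlt, hF]
    norm_num
  -- critical points of `g` on the tubes lie on the attaching circles
  have hgtube : ∀ j (y : RegularLevel hfa), y.1 ∈ (P.H.box j).chart.source →
      TubeModel.tube εT (2 / P.η) P.η ((P.H.box j).coord y.1) < 3 →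
      IsMCriticalPt (𝓡 3) g y → P.H.B j y.1 = 0 := by
    intro j y hy ht hc
    rw [← P.kap_eq] at ht
    have hF := hF_tube j y hy ht
    have hFlt : P.tubeSystem.heegaardFn εT P.kap 1 y.1 < 3 := by rw [hF]; exact ht
    -- `g = F/7` near `y`
    set F : X → ℝ := P.tubeSystem.heegaardFn εT P.kap 1 with hFdef
    have hFs : ContMDiff (𝓡 4) 𝓘(ℝ, ℝ) ∞ F := P.tubeSystem.contMDiff_heegaardFn hfs (P.size_le hεT1) hεT0.le P.kap_pos one_pos
    have hFY : ContMDiff (𝓡 3) 𝓘(ℝ, ℝ) ∞ (F ∘ RegularLevel.incl hfa) := hFs.comp (RegularLevel.contMDiff_incl hfa)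
    have hopen : IsOpen {p : RegularLevel hfa | F p.1 < 3} := isOpen_lt (hFY.continuous) continuous_const
    have hev : g =ᶠ[𝓝 y] fun p => (1 + 6 * 1)⁻¹ * (F ∘ RegularLevel.incl hfa) p := by
      filter_upwards [hopen.mem_nhds (show F y.1 < 3 from hFlt)] with p hp
      exact hexpl p (by show F p.1 < 1 + 2 * 1; linarith [show F p.1 < 3 from hp])
    have hc' : IsMCriticalPt (𝓡 3) (F ∘ RegularLevel.incl hfa) y := by
      have h1 := (LevelBlending.isMCriticalPt_congr_of_eventuallyEq (k := 2) hev).1 hc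
      exact (isMCriticalPt_const_mul_iff (I := 𝓡 3) (by norm_num) ((hFY y).mdifferentiableAt (by simp))).1 h1
    obtain ⟨j', hj', h2, h3, -⟩ := P.tubeSystem.morseData_of_isMCriticalPt (h := hfa) (P.size_le hεT1) hεT0 P.kap_pos one_pos y
      (by linarith) hc'
    -- the chart is `j`
    have hjj : j' = j := by
      by_contra hne
      exact (P.H.disjoint hne).le_bot ⟨by simpa using hj', hy⟩
    subst hjj
    rw [HandleBoxes.B_eq_bsq, RadialThickening.bsq_apply, P.coord_eq_centred, h2, h3]
    ring
  -- the unit field across `{g = b}` and a point of `{g = b}`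
  set V : LevelUnitField 2 g b := Classical.choice hb.exists_levelUnitField
  have hne : Nonempty (RegularLevel hb) := by
    haveI := conn₁; haveI := conn₂
    obtain ⟨p₁⟩ := (inferInstance : Nonempty (RegularSublevel hb))
    obtain ⟨p₂⟩ := (inferInstance : Nonempty (RegularSuperlevel hb))
    have h1 : g (RegularSublevel.incl hb p₁) ≤ b := RegularSublevel.apply_incl_le hb p₁
    have h2 : b ≤ g (RegularSublevel.incl hb.const_sub p₂) := by
      have := RegularSublevel.apply_incl_le hb.const_sub p₂
      change b - g _ ≤ 0 at this; linarith
    obtain ⟨y, -, hy⟩ := isPreconnected_univ.intermediate_value (mem_univ _) (mem_univ _) gMorse.contMDiff.continuous.continuousOn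
      (show b ∈ Icc (g (RegularSublevel.incl hb p₁)) (g (RegularSublevel.incl hb.const_sub p₂)) from ⟨h1, h2⟩)
    exact ⟨⟨y, hy⟩⟩
  exact ⟨⟨P, εT, hεT0, hεT1, hfa, U, ρU, hUδ, hρUs.continuous, hρU, hU_eq, hglU, connY, g, b, hb, gMorse, hgval, hb_lo, hb1,
    hgord₁, hgord₂, hφ, hgtube, conn₁, conn₂, V, hne, hℓreg, connℓ⟩, rfl, rfl⟩

/-- **Existence of collar data** on a closed connected smooth `4`-manifold (with `ε_T = 1/2`). [cite: GayKirby2016, §4, Lemma 14 and proof of Thm. 4] -/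
theorem exists_setupCollar : Nonempty (SetupCollar X) := by
  obtain ⟨P⟩ := exists_setupBoxes X
  obtain ⟨C, -, -⟩ := P.exists_collar (εT := 1 / 2) (by norm_num) le_rfl
  exact ⟨C⟩

end Literature.Topology.FourManifolds

end
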